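import Summits.Ventures.Crystal3D.Theorems.StickyWulffConstantNoReconstructionGainConfinedCertificate
import Summits.Ventures.Crystal3D.Theorems.StickyWulffConstantNoReconstructionGainExactThinNoCriminalB
import HarnessLib

/-!
# Height-confined `(111)` films: the windowed weighted-kissing bound PROVED for thin windows `W ≤ 7/20`,
# and the certificate pipeline closed end-to-end (line `replication-exactness`, inside `stub_noCriminal`)

HONEST FRAMING. Part of the venture `Summits/Ventures/Crystal3D` (cell `crystal3d-full`), helper `--supports` the
crux `NoReconstructionGain` (stmt-Ventures-19144, route `route-Ventures-StickyWulffConstant`), lead wulff-p1 g20.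
The reduction `not_isCriminal_basal_of_confinedCodeBound` (`…ConfinedCertificate`) turns the named shape
`ConfinedCodeBound W g` (`…ConfinedCertificateDefs`) into «no `(111)` criminal below height `(k+1)√(2/3) + W`».
Here the shape is PROVED — at the physical offsets `a ∈ [−W, 0]` (`ConfinedCodeBoundPhys`) — for every thin
window `W ≤ 7/20` and every admissible profile with `g(√(2/3) − √3/2) ≤ 4/3`, `g(√(2/3) − 1) ≤ 5/3`, by two
counting facts about a neighbour code `N = P ∪ F` (plug directions `P` at third coordinate `z₀ = a − √(2/3)`,
film directions `F` in `[a, a + W]`):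

* `card_mul_sq_le_of_sameHeight` — **plug directions are few and shallow plugs are fewer**: if `m` unit vectors
  with pairwise inner products `≤ 1/2` share the third coordinate `z₀`, then `m·z₀² ≤ (m+1)/2` (expand
  `‖Σ u‖² ≥ (Σ u₂)²`); so `m ≤ 3` when `z₀² ≥ 2/3`, `m ≤ 2` unless `z₀² ≤ 2/3`, `m ≤ 1` unless `z₀² ≤ 3/4`;
* `card_le_six_of_thinWindow` — at most SIX unit vectors with pairwise inner products `≤ 1/2` fit in a height
  window `[a, a + W] ⊆ [−7/20, 7/20]` (the tree's `seven_thin_unit_vectors_false'`);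
* `confinedCodeBoundPhys_of_thin` — hence `Σ_{u ∈ N} g(u₂) = 2m + Σ_F g ≤ 2m + 6·g(a) ≤ 12` in each of the
  cases `m = 3 ⇒ a = 0`, `m = 2 ⇒ a ≥ √(2/3) − √3/2`, `m = 1 ⇒ a ≥ √(2/3) − 1`, `m = 0`;
* `not_isCriminal_basal_of_confinedCodeBoundPhys` — the reduction re-run at the physical offsets;
* `not_isCriminal_basal_of_height_le_thin` — **UNCONDITIONAL**: over the close-packed layer `k` of `Λ₀`
  (`k√(2/3) ≤ s < (k+1)√(2/3)`) no film all of whose balls lie at height `≤ (k+1)√(2/3) + 7/20` is a criminal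
  (certificate: the clipped linear ramp `g z = min 2 (max 0 (1 − z/√(2/3)))`).

Compare `not_isCriminal_basal_of_low_offLattice` (`…ExactBasalBilayer`): height `≤ (k+1)√(2/3) + 1/4` asked of
the OFF-LATTICE balls only.  The point of this file is not the extra `1/10` but that the certificate pipeline
(shape ⟹ reduction ⟹ film theorem) runs end-to-end in the kernel; wider windows (`W ≈ 1.07–1.2`, the first two
adsorbed layers) are where the numerics of this generation (kit j330789/j330882/j330900) say a profile exists and a
spherical-code certificate is needed.  WHAT THIS IS NOT: nothing beyond `W ≤ 7/20`; other faces untouched; the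
crux and rung F-C1 not moved.
-/

noncomputable section

namespace Summit.Ventures.Crystal3D.Theorems

open Summit.Ventures.Crystal3D Finset
open Literature.MathematicalPhysics.StatisticalMechanics (fccStacking contactDeficiency barlowPos barlowPos_mem
  barlowPos_apply_two constHagg isHaggSeq_const le_dist_of_mem_barlowStacking_ideal)
open scoped InnerProductSpace

/-- The third coordinate is the `e₃`-height. -/
private theorem inner_e3'' (v : EuclideanSpace ℝ (Fin 3)) :
    ⟪v, EuclideanSpace.single 2 (1 : ℝ)⟫_ℝ = v 2 := by
  rw [EuclideanSpace.inner_single_right]; simp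

/-! ## Plug directions: few, and fewer when shallow -/

/-- **Same-height code vectors.**  If the `m` unit vectors of `P` have pairwise inner products `≤ 1/2` and a
common third coordinate `z₀`, then `m · z₀² ≤ (m + 1)/2`.  Proof: `S := Σ_{u∈P} u` has `S₂ = m z₀`, so
`m² z₀² ≤ ‖S‖² = Σ_u Σ_v ⟪u,v⟫ ≤ m + m(m−1)/2`. -/
theorem card_mul_sq_le_of_sameHeight (P : Finset (EuclideanSpace ℝ (Fin 3))) (z₀ : ℝ)
    (h1 : ∀ u ∈ P, ‖u‖ = 1) (h2 : ∀ u ∈ P, ∀ v ∈ P, u ≠ v → ⟪u, v⟫_ℝ ≤ 1 / 2)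
    (hz : ∀ u ∈ P, u 2 = z₀) : (P.card : ℝ) * z₀ ^ 2 ≤ ((P.card : ℝ) + 1) / 2 := by
  classical
  set S : EuclideanSpace ℝ (Fin 3) := ∑ u ∈ P, u with hS
  -- `S₂ = m z₀`
  have hS2 : ⟪S, EuclideanSpace.single 2 (1 : ℝ)⟫_ℝ = (P.card : ℝ) * z₀ := by
    rw [hS, sum_inner, Finset.sum_congr rfl fun u hu => by rw [inner_e3'', hz u hu], Finset.sum_const,
      nsmul_eq_mul]
  -- `(S₂)² ≤ ‖S‖²`
  have hlow : ((P.card : ℝ) * z₀) ^ 2 ≤ ‖S‖ ^ 2 := by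
    have h := abs_real_inner_le_norm S (EuclideanSpace.single 2 (1 : ℝ))
    rw [hS2, PiLp.norm_single, norm_one, mul_one] at h
    calc ((P.card : ℝ) * z₀) ^ 2 = |(P.card : ℝ) * z₀| ^ 2 := (sq_abs _).symm
      _ ≤ ‖S‖ ^ 2 := pow_le_pow_left₀ (abs_nonneg _) h 2
  -- `‖S‖² = Σ_u Σ_v ⟪u,v⟫ ≤ m + m(m-1)/2`
  have hup : ‖S‖ ^ 2 ≤ (P.card : ℝ) + (P.card : ℝ) * ((P.card : ℝ) - 1) / 2 := by
    rw [← real_inner_self_eq_norm_sq, hS, sum_inner]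
    have hrow : ∀ u ∈ P, ⟪u, ∑ v ∈ P, v⟫_ℝ ≤ 1 + ((P.card : ℝ) - 1) / 2 := by
      intro u hu
      rw [inner_sum, ← Finset.add_sum_erase P _ hu, real_inner_self_eq_norm_sq, h1 u hu, one_pow]
      have hb : ∑ v ∈ P.erase u, ⟪u, v⟫_ℝ ≤ ∑ v ∈ P.erase u, (1 / 2 : ℝ) :=
        Finset.sum_le_sum fun v hv => h2 u hu v (Finset.mem_of_mem_erase hv) (Finset.ne_of_mem_erase hv).symm
      rw [Finset.sum_const, nsmul_eq_mul, Finset.card_erase_of_mem hu, Nat.cast_sub (Finset.card_pos.2 ⟨u, hu⟩),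
        Nat.cast_one] at hb
      linarith
    calc ∑ u ∈ P, ⟪u, ∑ v ∈ P, v⟫_ℝ ≤ ∑ u ∈ P, (1 + ((P.card : ℝ) - 1) / 2) := Finset.sum_le_sum hrow
      _ = (P.card : ℝ) + (P.card : ℝ) * ((P.card : ℝ) - 1) / 2 := by
        rw [Finset.sum_const, nsmul_eq_mul]; ring
  -- combine: m² z₀² ≤ m + m(m-1)/2 = m(m+1)/2
  have hm : ((P.card : ℝ)) ^ 2 * z₀ ^ 2 ≤ (P.card : ℝ) * ((P.card : ℝ) + 1) / 2 := by nlinarith [hlow, hup]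
  rcases Nat.eq_zero_or_pos P.card with h0 | hpos
  · rw [h0]; norm_num
  · have hc : (0 : ℝ) < P.card := by exact_mod_cast hpos
    have : (P.card : ℝ) * ((P.card : ℝ) * z₀ ^ 2) ≤ (P.card : ℝ) * (((P.card : ℝ) + 1) / 2) := by nlinarith [hm]
    exact le_of_mul_le_mul_left this hc

/-! ## Film directions: at most six in a thin window -/

/-- **At most six code vectors in a thin height window.**  Unit vectors with pairwise inner products `≤ 1/2` whose
third coordinates all lie in a window `[a, a + W]` with `−7/20 ≤ a` and `a + W ≤ 7/20`, `0 ≤ W ≤ 7/20`, number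
at most six (`seven_thin_unit_vectors_false'` applied to seven of them). -/
theorem card_le_six_of_thinWindow (F : Finset (EuclideanSpace ℝ (Fin 3))) {a W : ℝ} (hW : W ≤ 7 / 20)
    (ha : -(7 / 20) ≤ a) (haW : a + W ≤ 7 / 20)
    (h1 : ∀ u ∈ F, ‖u‖ = 1) (h2 : ∀ u ∈ F, ∀ v ∈ F, u ≠ v → ⟪u, v⟫_ℝ ≤ 1 / 2)
    (hwin : ∀ u ∈ F, a ≤ u 2 ∧ u 2 ≤ a + W) : F.card ≤ 6 := by
  classical
  by_contra h7
  have h7' : 7 ≤ F.card := by omega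
  obtain ⟨T, hT, hTc⟩ := Finset.exists_subset_card_eq h7'
  set f := (T.equivFinOfCardEq hTc).symm with hf
  have hmem : ∀ i, ((f i : EuclideanSpace ℝ (Fin 3)) ∈ F) := fun i => hT (f i).2
  have he : ‖(EuclideanSpace.single 2 (1 : ℝ) : EuclideanSpace ℝ (Fin 3))‖ = 1 := by
    rw [PiLp.norm_single, norm_one]
  refine seven_thin_unit_vectors_false' (EuclideanSpace.single 2 (1 : ℝ)) he
    (fun i => (f i : EuclideanSpace ℝ (Fin 3))) (fun i => h1 _ (hmem i)) (fun i => ?_) (fun i j hij => ?_)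
    (fun i j => ?_)
  · rw [inner_e3'', abs_le]
    have h := hwin _ (hmem i)
    constructor <;> linarith [h.1, h.2]
  · have hne : (f i : EuclideanSpace ℝ (Fin 3)) ≠ f j := fun h => hij (f.injective (Subtype.ext h))
    have hin := h2 _ (hmem i) _ (hmem j) hne
    have hsq : ‖(f i : EuclideanSpace ℝ (Fin 3)) - f j‖ ^ 2 = 2 - 2 * ⟪(f i : EuclideanSpace ℝ (Fin 3)), f j⟫_ℝ := by
      rw [norm_sub_sq_real, h1 _ (hmem i), h1 _ (hmem j)]; ring
    nlinarith [norm_nonneg ((f i : EuclideanSpace ℝ (Fin 3)) - f j)]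
  · rw [inner_e3'', PiLp.sub_apply, abs_le]
    have hi := hwin _ (hmem i)
    have hj := hwin _ (hmem j)
    constructor <;> linarith [hi.1, hi.2, hj.1, hj.2]

/-! ## The windowed bound for thin windows -/

/-- **`ConfinedCodeBoundPhys W g` for every thin window `W ≤ 7/20`.**  Admissible profile: `g` antitone,
`g 0 = 1`, `g = 2` below `−√(2/3)`, and the two height checks `g(√(2/3) − √3/2) ≤ 4/3` (two plugs),
`g(√(2/3) − 1) ≤ 5/3` (one plug).  At offset `a ∈ [−W, 0]` a code splits into `m ≤ 3` plug directions at height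
`a − √(2/3)` (weight `2` each; `m ≥ 2` forces `a ≥ √(2/3) − √3/2`, `m = 3` forces `a = 0`) and at most six film
directions of weight `≤ g(a)` each. -/
theorem confinedCodeBoundPhys_of_thin {W : ℝ} (hW : W ≤ 7 / 20) {g : ℝ → ℝ} (hg : Antitone g)
    (hg0 : g 0 = 1) (hplug : ∀ z, z ≤ -Real.sqrt (2 / 3) → g z = 2)
    (hg2 : g (Real.sqrt (2 / 3) - Real.sqrt 3 / 2) ≤ 4 / 3) (hg1 : g (Real.sqrt (2 / 3) - 1) ≤ 5 / 3) :
    ConfinedCodeBoundPhys W g := by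
  classical
  intro a haW ha0 N h1 h2 h3
  set c : ℝ := Real.sqrt (2 / 3) with hc
  have hc2 : c ^ 2 = 2 / 3 := Real.sq_sqrt (by norm_num)
  have hcpos : 0 < c := Real.sqrt_pos.2 (by norm_num)
  have h3sq : Real.sqrt 3 ^ 2 = 3 := Real.sq_sqrt (by norm_num)
  have h3pos : 0 < Real.sqrt 3 := Real.sqrt_pos.2 (by norm_num)
  -- split the code into plug directions and film directions
  set P := N.filter (fun u => u 2 = a - c) with hP
  set F := N.filter (fun u => ¬ u 2 = a - c) with hF
  have hsplit : ∑ u ∈ N, g (u 2) = ∑ u ∈ P, g (u 2) + ∑ u ∈ F, g (u 2) :=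
    (Finset.sum_filter_add_sum_filter_not N (fun u => u 2 = a - c) (fun u => g (u 2))).symm
  have hPN : ∀ u ∈ P, u ∈ N ∧ u 2 = a - c := fun u hu => Finset.mem_filter.1 hu
  have hFN : ∀ u ∈ F, u ∈ N ∧ a ≤ u 2 ∧ u 2 ≤ a + W := by
    intro u hu
    obtain ⟨huN, hne⟩ := Finset.mem_filter.1 hu
    exact ⟨huN, (h3 u huN).resolve_left hne⟩
  -- plug part: `m` points of weight `2`, with `m z₀² ≤ (m+1)/2`
  have hPsum : ∑ u ∈ P, g (u 2) = 2 * (P.card : ℝ) := by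
    rw [Finset.sum_congr rfl fun u hu => by rw [(hPN u hu).2, hplug (a - c) (by linarith)], Finset.sum_const,
      nsmul_eq_mul, mul_comm]
  have hm := card_mul_sq_le_of_sameHeight P (a - c) (fun u hu => h1 u (hPN u hu).1)
    (fun u hu v hv huv => h2 u (hPN u hu).1 v (hPN v hv).1 huv) (fun u hu => (hPN u hu).2)
  -- film part: at most six points, each of weight `≤ g a`
  have hFcard : F.card ≤ 6 :=
    card_le_six_of_thinWindow F hW (by linarith) (by linarith) (fun u hu => h1 u (hFN u hu).1)
      (fun u hu v hv huv => h2 u (hFN u hu).1 v (hFN v hv).1 huv) (fun u hu => (hFN u hu).2)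
  have hga_nonneg : 0 ≤ g a := by
    have : g a ≥ g 0 := hg ha0
    linarith
  have hFsum : ∑ u ∈ F, g (u 2) ≤ 6 * g a := by
    calc ∑ u ∈ F, g (u 2) ≤ ∑ u ∈ F, g a := Finset.sum_le_sum fun u hu => hg (hFN u hu).2.1
      _ = (F.card : ℝ) * g a := by rw [Finset.sum_const, nsmul_eq_mul]
      _ ≤ 6 * g a := by
        have : (F.card : ℝ) ≤ 6 := by exact_mod_cast hFcard
        exact mul_le_mul_of_nonneg_right this hga_nonneg
  rw [hsplit, hPsum]
  -- case analysis on `m = P.card`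
  have hm3 : P.card ≤ 3 := by
    by_contra h4
    have h4' : (4 : ℝ) ≤ P.card := by exact_mod_cast (by omega : 4 ≤ P.card)
    -- z₀ = a - c ≤ -c, so z₀² ≥ 2/3
    have hz : 2 / 3 ≤ (a - c) ^ 2 := by nlinarith
    nlinarith [hm, hz]
  have hc35 : (7 : ℝ) / 20 ≤ c := by nlinarith
  have hga2 : g a ≤ 2 := by
    have : g a ≤ g (-c) := hg (by linarith)
    rw [hplug (-c) (by linarith)] at this; exact this
  interval_cases hPc : P.card
  · -- m = 0
    simp only [Nat.cast_zero, mul_zero, zero_add]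
    linarith
  · -- m = 1 : then a - c ≥ -1, i.e. a ≥ c - 1
    have hz1 : (a - c) ^ 2 ≤ 1 := by
      have h := hm; simp only [Nat.cast_one, one_mul] at h; linarith
    have ha1 : c - 1 ≤ a := by nlinarith
    have : g a ≤ g (c - 1) := hg ha1
    simp only [Nat.cast_one]
    linarith
  · -- m = 2 : then (a - c)² ≤ 3/4, i.e. a ≥ c - √3/2
    have hz2 : (a - c) ^ 2 ≤ 3 / 4 := by
      have h := hm; simp only [Nat.cast_ofNat] at h; linarith
    have ha2 : c - Real.sqrt 3 / 2 ≤ a := by nlinarith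
    have : g a ≤ g (c - Real.sqrt 3 / 2) := hg ha2
    simp only [Nat.cast_ofNat]
    linarith
  · -- m = 3 : then (a - c)² ≤ 2/3, so a = 0
    have hz3 : (a - c) ^ 2 ≤ 2 / 3 := by
      have h := hm; simp only [Nat.cast_ofNat] at h; linarith
    have ha3 : a = 0 := by nlinarith
    rw [ha3, hg0] at hFsum
    simp only [Nat.cast_ofNat]
    linarith

/-! ## The reduction at the physical offsets -/

/-- **The reduction, run at the physical offsets** (`ConfinedCodeBoundPhys` suffices): over the close-packed layer
`k` of `Λ₀` (`k√(2/3) ≤ s < (k+1)√(2/3)`), a profile `g` with `g z + g (−z) = 2`, `g = 2` below `−√(2/3)` and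
`ConfinedCodeBoundPhys W g` leave no criminal among the films confined below height `(k+1)√(2/3) + W`.  Same
proof as `not_isCriminal_basal_of_confinedCodeBound`, recording that the offset `(k+1)√(2/3) − q₂` of a film ball
`q` lies in `[−W, 0]`. -/
theorem not_isCriminal_basal_of_confinedCodeBoundPhys (k : ℤ) {s : ℝ} (hs : (k : ℝ) * Real.sqrt (2 / 3) ≤ s)
    (hs' : s < ((k : ℝ) + 1) * Real.sqrt (2 / 3)) {W : ℝ} {g : ℝ → ℝ} (hsym : ∀ z, g z + g (-z) = 2)
    (hplug : ∀ z, z ≤ -Real.sqrt (2 / 3) → g z = 2) (hW : ConfinedCodeBoundPhys W g)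
    {Q : Finset (EuclideanSpace ℝ (Fin 3))}
    (hconf : ∀ q ∈ Q, q 2 ≤ ((k : ℝ) + 1) * Real.sqrt (2 / 3) + W) :
    ¬ IsCriminal (EuclideanSpace.single 2 (1 : ℝ)) s Q := by
  classical
  intro hcrim
  have hQ : IsFilmOn (EuclideanSpace.single 2 (1 : ℝ)) s Q := hcrim.1
  set ν : EuclideanSpace ℝ (Fin 3) := EuclideanSpace.single 2 (1 : ℝ) with hν
  set c : ℝ := Real.sqrt (2 / 3) with hc
  have h23 : Real.sqrt (2 / 3) ^ 2 = 2 / 3 * (1 : ℝ) ^ 2 := by rw [Real.sq_sqrt (by norm_num)]; norm_num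
  refine not_isCriminal_of_fracOrientation (ν := ν) (s := s) (fun x q => g ((x - q) 2) / 2)
    (fun q _ q' _ _ => ?_) (fun q hq => ?_) hcrim
  · have : (q - q') 2 = -((q' - q) 2) := by simp [PiLp.sub_apply]
    rw [this]; linarith [hsym ((q' - q) 2)]
  · set P : Finset (EuclideanSpace ℝ (Fin 3)) := (plugSet_finite ν s q).toFinset with hP
    set F : Finset (EuclideanSpace ℝ (Fin 3)) := Q.filter (fun q' => dist q q' = 1) with hF
    have hPmem : ∀ p, p ∈ P ↔ p ∈ plugSet ν s q := fun p => by rw [hP, Set.Finite.mem_toFinset]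
    have hFmem : ∀ x, x ∈ F ↔ x ∈ Q ∧ dist q x = 1 := fun x => by rw [hF, Finset.mem_filter]
    have hdist1 : ∀ x ∈ F ∪ P, dist q x = 1 := by
      intro x hx
      rcases Finset.mem_union.1 hx with hx | hx
      · exact ((hFmem x).1 hx).2
      · exact ((hPmem x).1 hx).2
    have hsep : ∀ x ∈ F ∪ P, ∀ x' ∈ F ∪ P, x ≠ x' → 1 ≤ dist x x' := by
      intro x hx x' hx' hne
      rcases Finset.mem_union.1 hx with hx | hx <;> rcases Finset.mem_union.1 hx' with hx' | hx'
      · exact hQ.1 x ((hFmem x).1 hx).1 x' ((hFmem x').1 hx').1 hne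
      · exact hQ.2 x ((hFmem x).1 hx).1 x' ((hPmem x').1 hx').1
      · rw [dist_comm]; exact hQ.2 x' ((hFmem x').1 hx').1 x ((hPmem x).1 hx).1
      · exact le_dist_of_mem_barlowStacking_ideal isHaggSeq_const one_pos h23 ((hPmem x).1 hx).1.1
          ((hPmem x').1 hx').1.1 hne
    have hdisj : Disjoint F P := by
      rw [Finset.disjoint_left]
      intro x hxF hxP
      have h := hQ.2 x ((hFmem x).1 hxF).1 x ((hPmem x).1 hxP).1
      rw [dist_self] at h
      exact absurd h (by norm_num)
    set N : Finset (EuclideanSpace ℝ (Fin 3)) := (F ∪ P).image (fun x => x - q) with hN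
    have hinj : Set.InjOn (fun x => x - q) ↑(F ∪ P) := fun x _ x' _ h => sub_left_injective h
    have hN1 : ∀ u ∈ N, ‖u‖ = 1 := by
      intro u hu
      obtain ⟨x, hx, rfl⟩ := Finset.mem_image.1 hu
      rw [← dist_eq_norm, dist_comm]; exact hdist1 x hx
    have hN2 : ∀ u ∈ N, ∀ v ∈ N, u ≠ v → ⟪u, v⟫_ℝ ≤ 1 / 2 := by
      intro u hu v hv huv
      obtain ⟨x, hx, rfl⟩ := Finset.mem_image.1 hu
      obtain ⟨x', hx', rfl⟩ := Finset.mem_image.1 hv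
      have hne : x ≠ x' := fun h => huv (by rw [h])
      exact real_inner_sub_le_half_of_dist (hdist1 x hx) (hdist1 x' hx') (hsep x hx x' hx' hne)
    set a : ℝ := ((k : ℝ) + 1) * c - q 2 with ha
    have haW : -W ≤ a := by have := hconf q hq; rw [ha]; linarith
    have ha0 : a ≤ 0 := by have := le_height_of_isFilmOn_basal k hs hQ hq; rw [ha]; linarith
    have hN3 : ∀ u ∈ N, u 2 = a - Real.sqrt (2 / 3) ∨ (a ≤ u 2 ∧ u 2 ≤ a + W) := by
      intro u hu
      obtain ⟨x, hx, rfl⟩ := Finset.mem_image.1 hu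
      rw [PiLp.sub_apply]
      rcases Finset.mem_union.1 hx with hx | hx
      · right
        have hxQ := ((hFmem x).1 hx).1
        have hlo := le_height_of_isFilmOn_basal k hs hQ hxQ
        have hhi := hconf x hxQ
        constructor <;> [rw [ha]; rw [ha]] <;> linarith
      · left
        rw [plug_apply_two_eq_basal k hs hs' hQ hq ((hPmem x).1 hx), ha, hc]; ring
    have hbound := hW a haW ha0 N hN1 hN2 hN3
    rw [hN, Finset.sum_image hinj, Finset.sum_union hdisj] at hbound
    have hPsum : ∑ x ∈ P, g ((x - q) 2) = 2 * (P.card : ℝ) := by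
      rw [Finset.sum_congr rfl fun x hx => ?_, Finset.sum_const, nsmul_eq_mul, mul_comm]
      rw [PiLp.sub_apply, plug_apply_two_eq_basal k hs hs' hQ hq ((hPmem x).1 hx)]
      apply hplug
      have := le_height_of_isFilmOn_basal k hs hQ hq
      linarith
    have hcard : ((plugSet ν s q).ncard : ℝ) = P.card := by
      rw [hP, Set.ncard_eq_toFinset_card _ (plugSet_finite ν s q)]
    rw [hPsum] at hbound
    rw [hcard, ← Finset.sum_div]
    have : ∑ x ∈ F, g ((x - q) 2) = ∑ i ∈ F, g ((i - q) 2) := rfl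
    linarith

/-! ## The unconditional thin-film theorem through the pipeline -/

/-- **No `(111)` criminal below height `(k+1)√(2/3) + 7/20`** — unconditionally, through the certificate
pipeline: the clipped linear ramp `g z = min 2 (max 0 (1 − z/√(2/3)))` is admissible (`g z + g (−z) = 2`,
antitone, `g 0 = 1`, `= 2` below `−√(2/3)`, `g(√(2/3) − √3/2) = (√3/2)/√(2/3) ≤ 4/3`,
`g(√(2/3) − 1) = 1/√(2/3) ≤ 5/3`), so `confinedCodeBoundPhys_of_thin` and
`not_isCriminal_basal_of_confinedCodeBoundPhys` apply with `W = 7/20`. -/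
theorem not_isCriminal_basal_of_height_le_thin (k : ℤ) {s : ℝ} (hs : (k : ℝ) * Real.sqrt (2 / 3) ≤ s)
    (hs' : s < ((k : ℝ) + 1) * Real.sqrt (2 / 3)) {Q : Finset (EuclideanSpace ℝ (Fin 3))}
    (hconf : ∀ q ∈ Q, q 2 ≤ ((k : ℝ) + 1) * Real.sqrt (2 / 3) + 7 / 20) :
    ¬ IsCriminal (EuclideanSpace.single 2 (1 : ℝ)) s Q := by
  set c : ℝ := Real.sqrt (2 / 3) with hc
  have hc2 : c ^ 2 = 2 / 3 := Real.sq_sqrt (by norm_num)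
  have hcpos : 0 < c := Real.sqrt_pos.2 (by norm_num)
  have h3sq : Real.sqrt 3 ^ 2 = 3 := Real.sq_sqrt (by norm_num)
  have h3pos : 0 < Real.sqrt 3 := Real.sqrt_pos.2 (by norm_num)
  set g : ℝ → ℝ := fun z => min 2 (max 0 (1 - z / c)) with hg
  -- admissibility of the ramp
  have hclip : ∀ t : ℝ, min 2 (max 0 (1 - t)) + min 2 (max 0 (1 + t)) = 2 := by
    intro t
    simp only [min_def, max_def]
    split_ifs <;> linarith
  have hsym : ∀ z, g z + g (-z) = 2 := by
    intro z
    have h := hclip (z / c)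
    simp only [hg, neg_div]
    rwa [sub_neg_eq_add]
  have hanti : Antitone g := by
    intro x y hxy
    simp only [hg]
    have : 1 - y / c ≤ 1 - x / c := by
      have := div_le_div_of_nonneg_right hxy hcpos.le; linarith
    exact min_le_min le_rfl (max_le_max le_rfl this)
  have hg0 : g 0 = 1 := by simp [hg]
  have hplug : ∀ z, z ≤ -c → g z = 2 := by
    intro z hz
    simp only [hg]
    have h1 : 2 ≤ 1 - z / c := by
      have : z / c ≤ -1 := by rw [div_le_iff₀ hcpos]; linarith
      linarith
    rw [max_eq_right (by linarith), min_eq_left h1]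
  have hplug' : ∀ z, z ≤ -Real.sqrt (2 / 3) → g z = 2 := fun z hz => hplug z (by rw [hc]; exact hz)
  -- the ramp's value at `c - t` for `0 ≤ t ≤ 2c` is `t / c`
  have hval : ∀ t, 0 ≤ t → t ≤ 2 * c → g (c - t) = t / c := by
    intro t ht0 htc
    simp only [hg]
    have e : 1 - (c - t) / c = t / c := by field_simp; ring
    have h2 : t / c ≤ 2 := by rw [div_le_iff₀ hcpos]; linarith
    rw [e, max_eq_right (div_nonneg ht0 hcpos.le), min_eq_right h2]
  have hg2 : g (c - Real.sqrt 3 / 2) ≤ 4 / 3 := by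
    rw [hval _ (by positivity) (by nlinarith [mul_pos hcpos h3pos]), div_le_iff₀ hcpos]
    nlinarith [mul_pos hcpos h3pos]
  have hg1 : g (c - 1) ≤ 5 / 3 := by
    rw [hval 1 zero_le_one (by nlinarith), div_le_iff₀ hcpos]
    nlinarith
  exact not_isCriminal_basal_of_confinedCodeBoundPhys k hs hs' hsym hplug'
    (confinedCodeBoundPhys_of_thin le_rfl hanti hg0 hplug' hg2 hg1) hconf

end Summit.Ventures.Crystal3D.Theorems

end
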